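import Summits.CriticalPhenomena.PercolationContinuityZ3.Theorems.PercNearOneGluingNoHeavyQuantIndepBlobGapCalculus
import HarnessLib

/-!
# QUANT lane R8, FAR on general trees — the GAP CALCULUS for independent blobs (II): the COMPANION certificate for the
# open corner of Conjecture DIB\* (floor `> 1/2`, heavy total `≤ 2j`, light blobs present)

builds on p205010 (kernel theorem, internal audit signed; external expert review pending)

Support file (`--supports stmt-CriticalPhenomena-4575`), QUANT lane lead (gen 16), rung R8 of
`run/shared/lean/prim/quant/LADDER.md`; memo `run/shared/lean/prim/quant/prim-quant-lead-g16/LEAD-NOTES-G16.md` N30.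
Theorems only, no definitions, no sorries, standard axioms.  Vocabulary (restricted tail `TL_U`, gap property) as in part (I),
`…QuantIndepBlobGapCalculus`.

Conjecture DIB\* (`Quant.IndepBlob.DIBStar`, `…QuantDIBStar`; census-2 g49, README V185) is kernel for floors `x ≤ 1/2`
(`DIBStar.of_le_half`), at floors `≥ 1/2` whenever the heavy sizes total `≥ 2j+1` (`RootDec.term_ge_of_extraBlob`), and — by
census-1 g14's `IndepBlob.tail_ge_of_oneLight_corner` (`…QuantIndepBlobOneLightCorner`) — for ONE light blob at every floor; its open
part is the corner `x > 1/2`, heavy total `≤ 2j`, SEVERAL light blobs (`Quant.IndepBlob.DIBStarCorner`, typer g17), outside p1 g11's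
mergeable instances (`IndepBlob.tail_ge_of_gradedMerge`).  By the splitting certificate `IndepBlob.tail_ge_of_gapCert` it suffices
that the lights together with SOME heavy companions have the gap property at the shortfall; this file proves the single-companion
instance in closed form, for an arbitrary cloud of lights and with NO credit hypothesis:

* `Quant.IndepBlob.tail_ge_of_companion_cloud` — **THE COMPANION CERTIFICATE**: one heavy COMPANION `k₀` (`x ≤ p k₀`,
  `a k₀ ≥ e₀ := 2j + 1 − Σ_{heavy rest} a − a k₀`) and an arbitrary independent CLOUD `L` of further blobs (ANY gates) with
  `x(1 − p k₀)·P(N_L ≤ u) ≤ (1 − x)·p k₀·P(N_L ≥ e₀ − u)` for `0 ≤ u < e₀` ⟹ `x ≤ P(N ≥ j+1)`.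
* `Quant.IndepBlob.tailU_singleton` — the restricted tail of one blob.
* `Quant.IndepBlob.twoLevel_of_gap`, `twoLevelRow_of_heavy` — the UNWEIGHTED two-level rows from the gap property: levels
  `y ≤ v ≤ y + a k`, `y + v ≤ E + a k + 1` ⟹ `2x ≤ TL(y) + TL(v)`; in particular `2x ≤ P(N ≥ j) + P(N ≥ j+1)` for heavy systems with
  `Σ a ≥ 2j` (EVEN totals included; `twoLevelSizeRow_of_half_le_gate` asked `Σ a ≥ 2j+1`).
* `Quant.IndepBlob.tail_ge_of_companion_oneLight` — ONE LIGHT BLOB `(b, g)` of any gate plus a companion `(a₀, p₀ ≥ x)` with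
  `a₀ ≥ e₀`, `b ≥ e₀` and `odds(p₀)·odds(g) ≥ odds(x)`, i.e. `x(1 − p₀)(1 − g) ≤ (1 − x)p₀g` ⟹ `x ≤ P(N ≥ j+1)`.  For `g ≥ 1/2` EVERY
  heavy blob of size `≥ e₀` is a companion (`p₀ ≥ x ≥ 1/2 ≥ 1 − g`); `g ≥ 1/2` is the exact threshold of the smallest corner instance
  (two heavy units at the floor, one light unit, `j = 1`).  In DIB\*'s corner a light unit (`b = 1`) always has `g > x² + (1 − x)² ≥ 1/2`
  when the least heavy gate is the floor (LEAD-NOTES-G16 N30 (2)), so the case 'one light UNIT, floor attained' of DIB\* follows.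

Numerics (lead g16, `prim-quant-lead-g16/explore/check_lemmas.py`, `coverage.py`): the one-light companion row on 9 816 random
instances (companion and light sizes up to `j+1`, any light gate): 0 failures, `min P(N ≥ j+1)/x = 1.001`; on 42 031 exact DIB\*-corner
instances with 2–4 light blobs (`x ∈ (1/2, 1)`) the companion-cloud certificate covers 91.3 %, graded merge 85.1 %, the two together
97.0 %, and the splitting certificate with a larger companion set the remaining 1 256 (all).  [this work]; the gluing rows served:
[cite: KozmaNitzan2024, Conjecture 3 (p. 15)].
-/

namespace Summit.CriticalPhenomena.PercolationContinuityZ3.Theorems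

namespace Quant

namespace IndepBlob

open Finset

variable {κ : Type*} [DecidableEq κ]

/-! ### 4. The companion certificate (DIB\*'s open corner) -/

/-- **THE COMPANION CERTIFICATE.**  Gates in `[0,1]`, floor `1/2 ≤ x`; a CLOUD `L` of blobs (arbitrary gates), a COMPANION
`k₀ ∉ L` with `x ≤ p k₀`, and every other blob heavy (`x ≤ p k` off `insert k₀ L`).  Write `A''` for the total size of the other
blobs and `e₀ = 2j + 1 − A'' − a k₀` for the shortfall.  If `a k₀ ≥ e₀` (as `2j + 1 ≤ A'' + 2·a k₀`) and the cloud satisfies, for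
all levels `y, w ≥ 1` with `y + w = e₀ + 1`,
`x·(1 − p k₀)·P(N_L ≤ y − 1) ≤ (1 − x)·p k₀·P(N_L ≥ w)` (in tail form: `x(1 − p k₀)(1 − TL_L(y)) ≤ (1 − x) p k₀ TL_L(w)`),
then `x ≤ P(N ≥ j+1)`.  No credit hypothesis. [this work] -/
theorem tail_ge_of_companion_cloud [Fintype κ] (p : κ → ℝ) (a : κ → ℕ) (x : ℝ) (hx : 1 / 2 ≤ x) (hx1 : x ≤ 1)
    (hp0 : ∀ i, 0 ≤ p i) (hp1 : ∀ i, p i ≤ 1) (L : Finset κ) (k₀ : κ) (hk₀ : k₀ ∉ L) (hk₀x : x ≤ p k₀)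
    (hheavy : ∀ k, k ∉ insert k₀ L → x ≤ p k) (j : ℕ)
    (hbig : 2 * j + 1 ≤ (∑ k ∈ (insert k₀ L)ᶜ, a k) + 2 * a k₀)
    (hcloud : ∀ y w : ℕ, 1 ≤ y → 1 ≤ w → y + w + (∑ k ∈ (insert k₀ L)ᶜ, a k) + a k₀ = 2 * j + 2 →
      x * (1 - p k₀) * (1 - ∑ s ∈ L.powerset, (∏ i ∈ L, (if i ∈ s then p i else 1 - p i)) *
              (if y ≤ ∑ i ∈ s, a i then (1 : ℝ) else 0)) ≤
        (1 - x) * p k₀ * ∑ s ∈ L.powerset, (∏ i ∈ L, (if i ∈ s then p i else 1 - p i)) *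
              (if w ≤ ∑ i ∈ s, a i then (1 : ℝ) else 0)) :
    x ≤ ∑ s : Finset κ, (∏ i, (if i ∈ s then p i else 1 - p i)) * (if j + 1 ≤ ∑ i ∈ s, a i then (1 : ℝ) else 0) := by
  set A'' : ℕ := ∑ k ∈ (insert k₀ L)ᶜ, a k with hA
  set T : ℕ → ℝ := fun t => ∑ s ∈ L.powerset, (∏ i ∈ L, (if i ∈ s then p i else 1 - p i)) *
      (if t ≤ ∑ i ∈ s, a i then (1 : ℝ) else 0) with hT
  have hT0 : T 0 = 1 := by simp only [hT]; exact tailU_zero p a L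
  have hTnn : ∀ t, 0 ≤ T t := fun t => by simp only [hT]; exact tailU_nonneg p a L (fun i _ => hp0 i) (fun i _ => hp1 i) t
  have hTle : ∀ t, T t ≤ 1 := fun t => by simp only [hT]; exact tailU_le_one p a L (fun i _ => hp0 i) (fun i _ => hp1 i) t
  have hTanti : ∀ {t t' : ℕ}, t ≤ t' → T t' ≤ T t := fun htt => by
    simp only [hT]; exact tailU_antitone p a L (fun i _ => hp0 i) (fun i _ => hp1 i) htt
  have hcloud' : ∀ y w : ℕ, 1 ≤ y → 1 ≤ w → y + w + A'' + a k₀ = 2 * j + 2 →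
      x * (1 - p k₀) * (1 - T y) ≤ (1 - x) * p k₀ * T w := fun y w h1 h2 h3 => by
    simp only [hT]; exact hcloud y w h1 h2 h3
  set q := p k₀ with hq
  set b := a k₀ with hb
  have hx0 : 0 ≤ x := by linarith
  have h1x : 0 ≤ 1 - x := by linarith
  have hq1 : q ≤ 1 := hp1 k₀
  have hq0 : 0 ≤ q := hp0 k₀
  have h1q : 0 ≤ 1 - q := by linarith
  refine tail_ge_of_gapCert p a x hx hx1 hp0 hp1 (insert k₀ L) hheavy j ?_
  intro y v hyv hsum
  rw [tailU_insert p a L k₀ hk₀ y, tailU_insert p a L k₀ hk₀ v]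
  change x ≤ x * (q * T (y - b) + (1 - q) * T y) + (1 - x) * (q * T (v - b) + (1 - q) * T v)
  -- `y ≤ a k₀`, so the companion alone reaches level `y`
  have hyb : y - b = 0 := by omega
  rw [hyb, hT0]
  have hrest : 0 ≤ (1 - x) * ((1 - q) * T v) := mul_nonneg h1x (mul_nonneg h1q (hTnn v))
  by_cases hy0 : y = 0
  · subst hy0
    rw [hT0]
    have e1 : x * (q * 1 + (1 - q) * 1) + (1 - x) * (q * T (v - b) + (1 - q) * T v) - x =
        (1 - x) * (q * T (v - b)) + (1 - x) * ((1 - q) * T v) := by ring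
    have h2 : 0 ≤ (1 - x) * (q * T (v - b)) := mul_nonneg h1x (mul_nonneg hq0 (hTnn _))
    linarith [e1, h2, hrest]
  · -- `y ≥ 1`; the worst `v` gives `w' = 2j + 2 − A'' − a k₀ − y ≥ v − a k₀`
    have hy1 : 1 ≤ y := Nat.one_le_iff_ne_zero.mpr hy0
    have hyT : 0 ≤ x * ((1 - q) * T y) := mul_nonneg hx0 (mul_nonneg h1q (hTnn y))
    by_cases hvb : v - b = 0
    · rw [hvb, hT0]
      have e2 : x * (q * 1 + (1 - q) * T y) + (1 - x) * (q * 1 + (1 - q) * T v) - x =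
          (q - x) + x * ((1 - q) * T y) + (1 - x) * ((1 - q) * T v) := by ring
      have hqx : 0 ≤ q - x := by linarith
      linarith [e2, hqx, hyT, hrest]
    · have hw1 : 1 ≤ v - b := Nat.one_le_iff_ne_zero.mpr hvb
      set w' : ℕ := 2 * j + 2 - A'' - b - y with hw'
      have hw'ge : v - b ≤ w' := by omega
      have hw'1 : 1 ≤ w' := le_trans hw1 hw'ge
      have heq : y + w' + A'' + b = 2 * j + 2 := by omega
      have hc := hcloud' y w' hy1 hw'1 heq
      have hmono : T w' ≤ T (v - b) := hTanti hw'ge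
      have e3 : x * (q * 1 + (1 - q) * T y) + (1 - x) * (q * T (v - b) + (1 - q) * T v) - x =
          (1 - x) * q * (T (v - b) - T w') + ((1 - x) * q * T w' - x * (1 - q) * (1 - T y)) +
            (1 - x) * ((1 - q) * T v) := by ring
      have h4 : 0 ≤ (1 - x) * q * (T (v - b) - T w') := mul_nonneg (mul_nonneg h1x hq0) (sub_nonneg.mpr hmono)
      linarith [e3, h4, hc, hrest]

/-- The restricted tail of a single blob: `TL_{{ℓ}}(t) = (if t = 0 then 1 else if t ≤ a ℓ then p ℓ else 0)`, in the form
`TL_{{ℓ}}(t) = p ℓ·𝟙[t ≤ a ℓ] + (1 − p ℓ)·𝟙[t = 0]`. [this work] -/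
theorem tailU_singleton (p : κ → ℝ) (a : κ → ℕ) (ℓ : κ) (t : ℕ) :
    ∑ s ∈ ({ℓ} : Finset κ).powerset, (∏ i ∈ ({ℓ} : Finset κ), (if i ∈ s then p i else 1 - p i)) *
        (if t ≤ ∑ i ∈ s, a i then (1 : ℝ) else 0) =
      p ℓ * (if t ≤ a ℓ then (1 : ℝ) else 0) + (1 - p ℓ) * (if t = 0 then (1 : ℝ) else 0) := by
  have h := tailU_insert p a (∅ : Finset κ) ℓ (Finset.notMem_empty ℓ) t
  rw [Finset.insert_empty] at h
  rw [h]
  simp only [Finset.powerset_empty, Finset.sum_singleton, Finset.prod_empty, Finset.sum_empty, one_mul,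
    Nat.le_zero, tsub_eq_zero_iff_le]

/-- **One light blob and one companion.**  Gates in `[0,1]`, floor `1/2 ≤ x`; a blob `ℓ` of ARBITRARY gate `g = p ℓ` and size
`b = a ℓ`, a companion `k₀ ≠ ℓ` with `x ≤ p k₀`, all other blobs heavy with total size `A''`.  If `b ≥ e₀` and `a k₀ ≥ e₀` for the
shortfall `e₀ = 2j + 1 − A'' − a k₀` (as `2j + 1 ≤ A'' + a k₀ + b` and `2j + 1 ≤ A'' + 2 a k₀`) and
`odds(p k₀)·odds(g) ≥ odds(x)`, i.e. `x·(1 − p k₀)·(1 − g) ≤ (1 − x)·p k₀·g`, then `x ≤ P(N ≥ j+1)`.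
With `g ≥ 1/2` every heavy blob of size `≥ e₀` qualifies (`x(1 − p)(1 − g) ≤ (1 − x)p g` for `p ≥ x ≥ 1/2 ≥ 1 − g`);
for the smallest corner instance (two heavy units at `x`, one light unit, `j = 1`) the row holds iff `g ≥ 1/2`. [this work] -/
theorem tail_ge_of_companion_oneLight [Fintype κ] (p : κ → ℝ) (a : κ → ℕ) (x : ℝ) (hx : 1 / 2 ≤ x) (hx1 : x ≤ 1)
    (hp0 : ∀ i, 0 ≤ p i) (hp1 : ∀ i, p i ≤ 1) (ℓ k₀ : κ) (hne : k₀ ≠ ℓ) (hk₀x : x ≤ p k₀)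
    (hheavy : ∀ k, k ≠ k₀ → k ≠ ℓ → x ≤ p k) (j : ℕ)
    (hbig : 2 * j + 1 ≤ (∑ k ∈ ({k₀, ℓ} : Finset κ)ᶜ, a k) + 2 * a k₀)
    (hbℓ : 2 * j + 1 ≤ (∑ k ∈ ({k₀, ℓ} : Finset κ)ᶜ, a k) + a k₀ + a ℓ)
    (hodds : x * (1 - p k₀) * (1 - p ℓ) ≤ (1 - x) * p k₀ * p ℓ) :
    x ≤ ∑ s : Finset κ, (∏ i, (if i ∈ s then p i else 1 - p i)) * (if j + 1 ≤ ∑ i ∈ s, a i then (1 : ℝ) else 0) := by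
  have hk₀ : k₀ ∉ ({ℓ} : Finset κ) := by simp [hne]
  have hins : insert k₀ ({ℓ} : Finset κ) = {k₀, ℓ} := rfl
  refine tail_ge_of_companion_cloud p a x hx hx1 hp0 hp1 {ℓ} k₀ hk₀ hk₀x ?_ j (by simpa [hins] using hbig) ?_
  · intro k hk
    simp only [Finset.mem_insert, Finset.mem_singleton, not_or] at hk
    exact hheavy k hk.1 hk.2
  · intro y w hy hw hsum
    rw [hins] at hsum
    rw [tailU_singleton p a ℓ y, tailU_singleton p a ℓ w]
    have hy0 : ¬ (y = 0) := by omega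
    have hw0 : ¬ (w = 0) := by omega
    have hwb : w ≤ a ℓ := by omega
    simp only [hy0, hw0, if_false, hwb, if_true, mul_zero, add_zero, mul_one]
    have hx0 : 0 ≤ x := by linarith
    have h1q : 0 ≤ 1 - p k₀ := by linarith [hp1 k₀]
    by_cases hyb : y ≤ a ℓ
    · simp only [hyb, if_true, mul_one]
      exact hodds
    · simp only [hyb, if_false, mul_zero, sub_zero, mul_one]
      -- `y > b ≥ e₀` contradicts `w ≥ 1`
      exfalso
      omega

/-! ### 5. Two-level rows from the gap calculus (even totals included) -/

/-- **Two-level row from the gap property.**  If `U` has the gap property at `E` (any floor `x`), `k ∉ U` is heavy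
(`x ≤ p k ≤ 1`), and the levels `y ≤ v ≤ y + a k` satisfy `y + v ≤ E + a k + 1`, then the UNWEIGHTED two-level sum of `U + k`
is at least `2x`: `2x ≤ TL_{U+k}(y) + TL_{U+k}(v)` — the sum of the pairs `(y − a k, v)` and `(v − a k, y)` of `U`, and
`p k ≥ x` only helps since the shifted tails dominate. [this work] -/
theorem twoLevel_of_gap (p : κ → ℝ) (a : κ → ℕ) (x : ℝ) (U : Finset κ)
    (hp0 : ∀ i ∈ U, 0 ≤ p i) (hp1 : ∀ i ∈ U, p i ≤ 1) (k : κ) (hk : k ∉ U) (hkx : x ≤ p k) (hk1 : p k ≤ 1) (E : ℕ)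
    (hU : ∀ y v : ℕ, y ≤ v → y + v ≤ E + 1 →
      x ≤ x * (∑ s ∈ U.powerset, (∏ i ∈ U, (if i ∈ s then p i else 1 - p i)) *
              (if y ≤ ∑ i ∈ s, a i then (1 : ℝ) else 0)) +
          (1 - x) * (∑ s ∈ U.powerset, (∏ i ∈ U, (if i ∈ s then p i else 1 - p i)) *
              (if v ≤ ∑ i ∈ s, a i then (1 : ℝ) else 0)))
    (y v : ℕ) (hyv : y ≤ v) (hvy : v ≤ y + a k) (hsum : y + v ≤ E + a k + 1) :
    2 * x ≤ (∑ s ∈ (insert k U).powerset, (∏ i ∈ insert k U, (if i ∈ s then p i else 1 - p i)) *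
              (if y ≤ ∑ i ∈ s, a i then (1 : ℝ) else 0)) +
          (∑ s ∈ (insert k U).powerset, (∏ i ∈ insert k U, (if i ∈ s then p i else 1 - p i)) *
              (if v ≤ ∑ i ∈ s, a i then (1 : ℝ) else 0)) := by
  rw [tailU_insert p a U k hk y, tailU_insert p a U k hk v]
  set T : ℕ → ℝ := fun t => ∑ s ∈ U.powerset, (∏ i ∈ U, (if i ∈ s then p i else 1 - p i)) *
      (if t ≤ ∑ i ∈ s, a i then (1 : ℝ) else 0) with hT
  have hT0 : T 0 = 1 := by simp only [hT]; exact tailU_zero p a U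
  have hTnn : ∀ t, 0 ≤ T t := fun t => by simp only [hT]; exact tailU_nonneg p a U hp0 hp1 t
  have hTanti : ∀ {t t' : ℕ}, t ≤ t' → T t' ≤ T t := fun htt => by
    simp only [hT]; exact tailU_antitone p a U hp0 hp1 htt
  have hU' : ∀ y v : ℕ, y ≤ v → y + v ≤ E + 1 → x ≤ x * T y + (1 - x) * T v := fun y v h1 h2 => by
    simp only [hT]; exact hU y v h1 h2
  set q := p k with hq
  set b := a k with hb
  have h1x : 0 ≤ 1 - x := by linarith [le_trans hkx hk1]
  change 2 * x ≤ q * T (y - b) + (1 - q) * T y + (q * T (v - b) + (1 - q) * T v)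
  have P1 : x ≤ x * T (y - b) + (1 - x) * T v := by
    by_cases hby : b ≤ y
    · exact hU' (y - b) v (by omega) (by omega)
    · have h0 : y - b = 0 := by omega
      rw [h0, hT0]; nlinarith [hTnn v]
  have P2 : x ≤ x * T (v - b) + (1 - x) * T y := by
    by_cases hbv : b ≤ v
    · exact hU' (v - b) y (by omega) (by omega)
    · have h0 : v - b = 0 := by omega
      rw [h0, hT0]; nlinarith [hTnn y]
  have hmy : T y ≤ T (y - b) := hTanti (Nat.sub_le y b)
  have hmv : T v ≤ T (v - b) := hTanti (Nat.sub_le v b)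
  have hqx : 0 ≤ q - x := by linarith
  nlinarith [P1, P2, mul_nonneg hqx (sub_nonneg.mpr hmy), mul_nonneg hqx (sub_nonneg.mpr hmv)]

/-- **The two-level row at EVEN (or any) total.**  Gates `x ≤ p i ≤ 1`, `1/2 ≤ x`, integer sizes with `2j ≤ Σ a` and at least one
blob of positive size ⟹ `2x ≤ P(N ≥ j) + P(N ≥ j+1)`.  (`twoLevelSizeRow_of_half_le_gate`, `…QuantIndepBlobCompanionRow`, asks
`Σ a ≥ 2j+1`; here the even case follows from the gap property of the system minus one blob.) [this work] -/
theorem twoLevelRow_of_heavy [Fintype κ] (p : κ → ℝ) (a : κ → ℕ) (x : ℝ) (hx : 1 / 2 ≤ x) (hpx : ∀ i, x ≤ p i)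
    (hp1 : ∀ i, p i ≤ 1) (j : ℕ) (hsize : 2 * j ≤ ∑ i, a i) (k : κ) (hk : 1 ≤ a k) :
    2 * x ≤ (∑ s : Finset κ, (∏ i, (if i ∈ s then p i else 1 - p i)) * (if j ≤ ∑ i ∈ s, a i then (1 : ℝ) else 0)) +
      ∑ s : Finset κ, (∏ i, (if i ∈ s then p i else 1 - p i)) * (if j + 1 ≤ ∑ i ∈ s, a i then (1 : ℝ) else 0) := by
  have hx0 : 0 ≤ x := by linarith
  have hp0 : ∀ i, 0 ≤ p i := fun i => le_trans hx0 (hpx i)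
  set U : Finset κ := Finset.univ.erase k with hU
  have hkU : k ∉ U := by simp [hU]
  have hins : insert k U = Finset.univ := by
    rw [hU, Finset.insert_erase (Finset.mem_univ k)]
  -- the rest `U` has the gap property at `Σ_{U} a` (gap_union from the empty set)
  have hS : ∀ y v : ℕ, y ≤ v → y + v ≤ 0 + 1 →
      x ≤ x * (∑ s ∈ (∅ : Finset κ).powerset, (∏ i ∈ (∅ : Finset κ), (if i ∈ s then p i else 1 - p i)) *
              (if y ≤ ∑ i ∈ s, a i then (1 : ℝ) else 0)) +
          (1 - x) * (∑ s ∈ (∅ : Finset κ).powerset, (∏ i ∈ (∅ : Finset κ), (if i ∈ s then p i else 1 - p i)) *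
              (if v ≤ ∑ i ∈ s, a i then (1 : ℝ) else 0)) := by
    intro y v hyv hsum
    have hy : y = 0 := by omega
    subst hy
    rw [tailU_zero p a ∅]
    have hnn := tailU_nonneg p a (∅ : Finset κ) (fun i _ => hp0 i) (fun i _ => hp1 i) v
    have hx1 : x ≤ 1 := le_trans (hpx k) (hp1 k)
    nlinarith [mul_nonneg (sub_nonneg.mpr hx1) hnn]
  have hgapU := gap_union p a x hx hp0 hp1 ∅ 0 hS U (Finset.disjoint_empty_left _) (fun i _ => hpx i)
  rw [Finset.empty_union, zero_add] at hgapU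
  have hsum' : ∑ i ∈ U, a i + a k = ∑ i, a i := by
    rw [hU, Finset.sum_erase_add _ _ (Finset.mem_univ k)]
  have h := twoLevel_of_gap p a x U (fun i _ => hp0 i) (fun i _ => hp1 i) k hkU (hpx k) (hp1 k) (∑ i ∈ U, a i)
    hgapU j (j + 1) (Nat.le_succ j) (by omega) (by omega)
  rw [hins, tailU_univ, tailU_univ] at h
  exact h

end IndepBlob

end Quant

end Summit.CriticalPhenomena.PercolationContinuityZ3.Theorems
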